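import Literature.Computability.Complexity.NSUBEXPGuardedBall
import Literature.Computability.Complexity.IndexAllBricks
import HarnessLib

/-!
# Kabanets–Impagliazzo 2003, Lemma 3: `P^{g} ⊆ NSUBEXP` when the graph of `g` is in `NSUBEXP`

Class level (no machine is programmed). Kabanets–Impagliazzo 2003, p. 357: "We say
that Perm is computable in `NTIME(t)` if the following language is in `NTIME(t)`:
`{(M, v) | M is a 0-1 matrix and v = Perm(M)}`. Note that if `Perm ∈ NTIME(t)`, then
`Perm ∈ coNTIME(t)`, and so we obtain the following lemma. **Lemma 3.** If `Perm ∈ NTIME(t)`, then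
`P^{Perm} ⊆ NTIME(poly(n) t(poly(n)))`." The proof is not printed (folklore: guess every oracle answer
together with its certificate); it is used on p. 359 with all `t = 2^{n^ε}`, i.e. as
`Perm ∈ NSUBEXP ⟹ P^{Perm} ⊆ NSUBEXP`. This file proves that instance for an ARBITRARY polynomially
bounded function oracle `g : {0,1}* → ℕ` (answers in binary, `Oracle.ofFun g`), in the transcript
model of `Oracle.lean`:

* `fnGraph g = {⟨u, bin (g u)⟩ | u}` — the graph language of `g`;
* **`PRel_ofFun_subset_NSUBEXP_of_fnGraph`**: if `|bin (g u)| ≤ s(|u|)` for a polynomial `s` and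
  `fnGraph g ∈ NSUBEXP` then `PRel (Oracle.ofFun g) ⊆ NSUBEXP`.

The permanent instance (`per01Fn`, whose graph on canonical matrix codes is `permanent01Graph`) is
drawn in `AlgebraicComplexity/ValiantBooleanBridgeProofs.lean`.

## Proof

For `L ∈ P^g` (algorithm `M`, budget `q`) a certificate is the `listBool` code
`Y = ⟨1ᵏ, body as⟩` of a guessed answer list `as = [a₀, …, a_{k-1}]`. With `w = ⟨x, Y⟩`:
`R` = "for every `j < k` the step of `M` on `x` after the answers `a₀ … a_{j-1}` is a query, and the
step after all `k` answers outputs `1`" (a polynomial-time condition: `Brick`-algebra replay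
`stepStr`, bounded conjunction `Brick.ballLen_mem_P` of `IndexAllBricks.lean`); `S` = "`j < k`"; `f ⟨w, 1ʲ⟩ = ⟨query of round j, aⱼ⟩`.
Then `L` is the guarded ball of `fnGraph g` along `(R, S, f)` (`mem_PRel_iff_guardedBall`: a
certified answer list is the genuine transcript, by induction on the rounds and injectivity of the
pairing; conversely the genuine transcript is certified), and `mem_NSUBEXP_of_guardedBall`
(`NSUBEXPGuardedBall.lean`) applies.

## References

* V. Kabanets, R. Impagliazzo, *Derandomizing polynomial identity tests means proving circuit
  lower bounds*, STOC 2003, §2.1 and Lemma 3 (p. 357), proof of Thm. 18 (p. 359).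
* S. Arora, B. Barak, *Computational Complexity: A Modern Approach*, CUP 2009, §3.4 (oracle
  machines), Def. 2.1 (certificates).
-/

namespace Literature.Computability.Complexity

open _root_.Computability Polynomial Brick PRelSigPi PRelSigma OracleCompose

/-! ### The graph language of a function oracle -/

/-- **The graph language** of `g : {0,1}* → ℕ`: the pairs `⟨u, bin (g u)⟩` (Kabanets–Impagliazzo
2003, §2.1: "the language `{(M, v) | … v = Perm(M)}`", for a general function). [cite: KabanetsImpagliazzo2003, §2.1 (p. 357)] -/
def fnGraph (g : List Bool → ℕ) : Language Bool :=
  {w | ∃ u : List Bool, w = boolPair u (encodeNat (g u))}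

/-- Membership of a pair in the graph language: the second component is the answer of the oracle
`Oracle.ofFun g`. [folklore] -/
theorem boolPair_mem_fnGraph_iff (g : List Bool → ℕ) (u a : List Bool) :
    boolPair u a ∈ fnGraph g ↔ a = Oracle.ofFun g u := by
  constructor
  · rintro ⟨u', h⟩
    obtain ⟨rfl, rfl⟩ := boolPair_injective h |> Prod.mk.inj
    rfl
  · rintro rfl
    exact ⟨u, rfl⟩

namespace FnGraph

/-! ### Reading the certificate `Y = ⟨1ᵏ, body as⟩` -/

/-- The first `j` answers read off an answer body `csb` (junk-tolerant list access `elemOf`). [folklore] -/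
def ansTakeC (csb : List Bool) (j : ℕ) : List (List Bool) := (List.range j).map (elemOf csb)

/-- The guessed answers read off the certificate `Y`: `aOf Y i = (sndF Y)[i]`. [folklore] -/
def aOf (Y : List Bool) (i : ℕ) : List Bool := elemOf (sndF Y) i

/-- The first `j` guessed answers of the certificate `Y`. [folklore] -/
def ansTake (Y : List Bool) (j : ℕ) : List (List Bool) := ansTakeC (sndF Y) j

/-- Length of `ansTakeC`. [folklore] -/
@[simp] theorem length_ansTakeC (csb : List Bool) (j : ℕ) : (ansTakeC csb j).length = j := by simp [ansTakeC]

/-- Length of `ansTake`. [folklore] -/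
@[simp] theorem length_ansTake (Y : List Bool) (j : ℕ) : (ansTake Y j).length = j := by simp [ansTake]

/-- One more answer. [folklore] -/
theorem ansTake_succ (Y : List Bool) (j : ℕ) : ansTake Y (j + 1) = ansTake Y j ++ [aOf Y j] := by
  simp [ansTake, ansTakeC, aOf, List.range_succ]

/-- On the code of a genuine answer list the reader returns it. [folklore] -/
theorem aOf_code (hdr : List Bool) (as : List (List Bool)) {i : ℕ} (hi : i < as.length) :
    aOf (boolPair hdr (body as)) i = as[i] := by
  rw [aOf, sndF_boolPair, elemOf_body, List.getD_eq_getElem _ _ hi]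

/-- On the code of a genuine answer list, `ansTake` returns its prefixes. [folklore] -/
theorem ansTake_code (hdr : List Bool) (as : List (List Bool)) {j : ℕ} (hj : j ≤ as.length) :
    ansTake (boolPair hdr (body as)) j = as.take j := by
  refine List.ext_getElem (by simp; omega) fun i h₁ h₂ => ?_
  have hi : i < as.length := by simp at h₁; omega
  simp only [ansTake, ansTakeC, sndF_boolPair, List.getElem_map, List.getElem_range, List.getElem_take]
  have := aOf_code hdr as hi
  rwa [aOf, sndF_boolPair] at this

/-- The `body` code of a list is the concatenation of the one-entry codes of its items. [folklore] -/
theorem body_eq_ccat (a : ℕ → List Bool) : ∀ j : ℕ, body ((List.range j).map a) = ccat (fun i => boolPair (a i) []) j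
  | 0 => rfl
  | j + 1 => by
    rw [List.range_succ, List.map_append, List.map_singleton, ccat_succ, ← body_eq_ccat a j]
    induction (List.range j).map a with
    | nil => rfl
    | cons b l ih => simp [body_cons, ih, boolPair]

/-! ### The transcript code and the replayed step as `FP` string functions

On `v = ⟨w, J⟩`, `w = ⟨x, Y⟩`: the `listBool` code of `ansTake Y |J|`, the step of `M` on `x` after
these answers, the guarded word's query/answer pair. -/

section Replay

variable (M : OracleAlg Bool)

/-- The certificate's answer body read off `v = ⟨⟨x, Y⟩, J⟩`. [folklore] -/
def csbV : List Bool → List Bool := sndF ∘ sndF ∘ fstF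

/-- `csbV ∈ FP`. [folklore] -/
theorem csbV_mem_FP : csbV ∈ FP := comp_mem_FP sndF_mem_FP (comp_mem_FP sndF_mem_FP fstF_mem_FP)

/-- `csbV ⟨⟨x, Y⟩, J⟩ = sndF Y`. [folklore] -/
@[simp] theorem csbV_apply (x Y J : List Bool) : csbV (boolPair (boolPair x Y) J) = sndF Y := by simp [csbV]

/-- The piece function of the transcript fold: `⟨v, 1ⁱ⟩ ↦ ⟨(csbV v)[i], ε⟩`. [folklore] -/
noncomputable def trPiece : List Bool → List Bool :=
  fanoutFn (elemFn ∘ fanoutFn sndF (csbV ∘ fstF)) fun _ => []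

/-- `trPiece ∈ FP`. [folklore] -/
theorem trPiece_mem_FP : trPiece ∈ FP :=
  fanoutFn_mem_FP (comp_mem_FP elemFn_mem_FP (fanoutFn_mem_FP sndF_mem_FP (comp_mem_FP csbV_mem_FP fstF_mem_FP)))
    (const_mem_FP [])

/-- Value of `trPiece`. [folklore] -/
@[simp] theorem trPiece_apply (v u : List Bool) : trPiece (boolPair v u) = boolPair (elemOf (csbV v) u.length) [] := by
  simp [trPiece, elemFn_boolPair]

/-- `trPiece` grows linearly in its first field, on every input. [folklore] -/
theorem length_trPiece_le (z : List Bool) : (trPiece z).length ≤ 4 * ((fstF z).length + 1) := by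
  have h : trPiece z = boolPair (elemOf (csbV (fstF z)) (sndF z).length) [] := by
    have hz : trPiece z = trPiece (boolPair (fstF z) (sndF z)) := by
      simp [trPiece, elemFn, fstF, sndF]
    rw [hz, trPiece_apply]
  rw [h, length_boolPair]
  have h1 := length_elemOf_le (csbV (fstF z)) (sndF z).length
  have h2 : (csbV (fstF z)).length ≤ (fstF z).length := by
    have a := length_fstF_sndF_le (fstF z)
    have b := length_fstF_sndF_le (fstF (fstF z))
    have c := length_fstF_sndF_le (sndF (fstF (fstF z)))
    simp only [csbV, Function.comp_apply]
    omega
  simp only [List.length_nil]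
  omega

/-- **The transcript code** of `v = ⟨w, J⟩`: `⟨1^{|J|}, body (ansTake Y |J|)⟩`, the `listBool` code
of the first `|J|` guessed answers (header `onesFn`, body by the concatenation fold of `trPiece`).
[folklore] -/
noncomputable def trFn : List Bool → List Bool :=
  fanoutFn (onesFn ∘ sndF)
    (sndPow 2 ∘ foldLoop appF trPiece X ∘ fanoutFn id (fanoutFn (lenBinF ∘ sndF) fun _ => boolPair [] []))

/-- `trFn ∈ FP`. [cite: AroraBarakCC2009, §1.3 (bounded loops)] -/
theorem trFn_mem_FP : trFn ∈ FP :=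
  fanoutFn_mem_FP (comp_mem_FP onesFn_mem_FP sndF_mem_FP)
    (comp_mem_FP (sndPow_mem_FP 2)
      (comp_mem_FP (foldLoop_mem_FP appF_mem_FP length_appF_le trPiece_mem_FP length_trPiece_le X)
        (fanoutFn_mem_FP OracleCompose.id_mem_FP
          (fanoutFn_mem_FP (comp_mem_FP lenBinF_mem_FP sndF_mem_FP) (const_mem_FP _)))))

/-- **Value of the transcript code on every string**: the `listBool` code of the first `|sndF v|`
answers read off `csbV v`. [folklore] -/
theorem trFn_eq (v : List Bool) :
    trFn v = (encodingList Bool).listBool.encode (ansTakeC (csbV v) (sndF v).length) := by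
  have hinit : fanoutFn id (fanoutFn (lenBinF ∘ sndF) fun _ => boolPair [] []) v =
      boolPair v (boolPair (encodeNat (sndF v).length) (boolPair (ones 0) [])) := by
    simp [ones]
  have hJ : (sndF v).length ≤ X.eval v.length := by
    have := length_fstF_sndF_le v
    simp only [eval_X]
    omega
  rw [trFn, fanoutFn_apply, Function.comp_apply, Function.comp_apply, Function.comp_apply, hinit,
    foldLoop_apply appF trPiece hJ 0 [], sndPow_succ_boolPair, sndPow_succ_boolPair, sndPow_zero_boolPair,
    foldAcc_appF, List.nil_append, OracleCompose.listBool_encode_eq, length_ansTakeC]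
  have hhdr : onesFn (sndF v) = unaryEncodeNat (sndF v).length := rfl
  have hcc : ccat (fun j => trPiece (boolPair v (ones (0 + j)))) (sndF v).length =
      ccat (fun i => boolPair (elemOf (csbV v) i) []) (sndF v).length :=
    ccat_congr fun i _ => by rw [trPiece_apply]; simp [ones]
  rw [hcc, hhdr, boolPair_unaryEncodeNat, ansTakeC, body_eq_ccat]

/-- Value of the transcript code on a round word: the `listBool` code of `ansTake Y |J|`. [folklore] -/
theorem trFn_apply (x Y J : List Bool) :
    trFn (boolPair (boolPair x Y) J) = (encodingList Bool).listBool.encode (ansTake Y J.length) := by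
  rw [trFn_eq, csbV_apply, sndF_boolPair, ansTake]

/-- **The replayed step** of `M` on `v = ⟨⟨x, Y⟩, J⟩`: the `sumBool` code of
`M.step x (ansTake Y |J|)` (`0 y` for the query `y`, `1 b` for the output `b`); on every string it
reads `x`, the answer body and the round through the projections. [folklore] -/
noncomputable def stepStr (v : List Bool) : List Bool :=
  stepCode (M.step (fstF (fstF v)) (ansTakeC (csbV v) (sndF v).length))

/-- **`stepStr M ∈ FP`** for polynomial-time `M`: the step machine precomposed with the
polynomial-time maps producing its input and transcript code (as `PRelSigma.stepCode_comp_mem_FP`,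
for string answers). [cite: AroraBarakCC2009, Thm. 2.8 (composition)] -/
theorem stepStr_mem_FP (hM : M.IsPolyTime encodingBoolBool) : stepStr M ∈ FP := by
  have hin : pairFn (fstF ∘ fstF) trFn ∈ FP := pairFn_mem_FP (comp_mem_FP fstF_mem_FP fstF_mem_FP) trFn_mem_FP
  have hG : PolyTimeComputable (id : List Bool → List Bool)
      (fun p : List Bool × List (List Bool) => boolPair p.1 ((encodingList Bool).listBool.encode p.2))
      (fun v => (fstF (fstF v), ansTakeC (csbV v) (sndF v).length)) := by
    obtain ⟨p, Mx, h⟩ := hin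
    refine ⟨p, Mx, fun v => ?_⟩
    have hv := h v
    simp only [id, pairFn_apply, Function.comp_apply, trFn_eq] at hv ⊢
    exact hv
  obtain ⟨p, Mx, h⟩ := PolyTimeComputable.comp_holds hM hG
  exact ⟨p, Mx, fun v => h v⟩

/-- Value of the replayed step on a round word. [folklore] -/
theorem stepStr_apply (x Y J : List Bool) :
    stepStr M (boolPair (boolPair x Y) J) = stepCode (M.step x (ansTake Y J.length)) := by
  simp [stepStr, ansTake]

end Replay

/-! ### The guard, the round condition, the replay language, the query/answer map -/

section Languages

variable (M : OracleAlg Bool)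

/-- The test `[|J| < |fstF Y|]` ("round `|J|` is a query round") on `v = ⟨⟨x, Y⟩, J⟩`. [folklore] -/
noncomputable def jltkFn : List Bool → List Bool := ltLenF ∘ fanoutFn sndF (fstF ∘ sndF ∘ fstF)

/-- The test `[|fstF Y| < |J|]` on `v = ⟨⟨x, Y⟩, J⟩`. [folklore] -/
noncomputable def kltjFn : List Bool → List Bool := ltLenF ∘ fanoutFn (fstF ∘ sndF ∘ fstF) sndF

/-- **The guard `S`**: the round words `⟨⟨x, Y⟩, J⟩` with `|J| < k`, `k = |fstF Y|` the number of
guessed answers. [folklore] -/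
def SLt : Language Bool := {v | jltkFn v = [true]}

/-- The round words with `k < |J|`. [folklore] -/
def KLt : Language Bool := {v | kltjFn v = [true]}

/-- `SLt ∈ P`. [folklore] -/
theorem SLt_mem_P : SLt ∈ Classes.P :=
  mem_P_of_mem_FP (comp_mem_FP ltLenF_mem_FP (fanoutFn_mem_FP sndF_mem_FP
    (comp_mem_FP fstF_mem_FP (comp_mem_FP sndF_mem_FP fstF_mem_FP)))) _ fun v =>
    ⟨fun h => h, fun h => (oneBit_ltLenF _).elim fun b hb => by
      cases b
      · exact hb
      · exact absurd hb h⟩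

/-- `KLt ∈ P`. [folklore] -/
theorem KLt_mem_P : KLt ∈ Classes.P :=
  mem_P_of_mem_FP (comp_mem_FP ltLenF_mem_FP (fanoutFn_mem_FP
    (comp_mem_FP fstF_mem_FP (comp_mem_FP sndF_mem_FP fstF_mem_FP)) sndF_mem_FP)) _ fun v =>
    ⟨fun h => h, fun h => (oneBit_ltLenF _).elim fun b hb => by
      cases b
      · exact hb
      · exact absurd hb h⟩

/-- Membership of a round word in `SLt`. [folklore] -/
@[simp] theorem mem_SLt_iff (x Y J : List Bool) :
    boolPair (boolPair x Y) J ∈ SLt ↔ J.length < (fstF Y).length := by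
  change (ltLenF ∘ fanoutFn sndF (fstF ∘ sndF ∘ fstF)) (boolPair (boolPair x Y) J) = [true] ↔ _
  simp

/-- Membership of a round word in `KLt`. [folklore] -/
@[simp] theorem mem_KLt_iff (x Y J : List Bool) :
    boolPair (boolPair x Y) J ∈ KLt ↔ (fstF Y).length < J.length := by
  change (ltLenF ∘ fanoutFn (fstF ∘ sndF ∘ fstF) sndF) (boolPair (boolPair x Y) J) = [true] ↔ _
  simp

/-- **The round condition** on `⟨⟨x, Y⟩, J⟩`, `k = |fstF Y|`: if `|J| < k` the replayed step is a
query, and if `|J| = k` it outputs `1`. [folklore] -/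
def roundT : Language Bool :=
  (SLtᶜ ⊔ stepStr M ⁻¹' HeadIs false) ⊓
    ((SLt ⊔ KLt) ⊔ (stepStr M ⁻¹' HeadIs true ⊓ (List.tail ∘ stepStr M) ⁻¹' HeadIs true))

/-- `roundT M ∈ P` for polynomial-time `M`. [folklore] -/
theorem roundT_mem_P (hM : M.IsPolyTime encodingBoolBool) : roundT M ∈ Classes.P :=
  inter_mem_P (union_mem_P (compl_mem_P_iff.2 SLt_mem_P) (preimage_mem_P (HeadIs_mem_P false) (stepStr_mem_FP M hM)))
    (union_mem_P (union_mem_P SLt_mem_P KLt_mem_P)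
      (inter_mem_P (preimage_mem_P (HeadIs_mem_P true) (stepStr_mem_FP M hM))
        (preimage_mem_P (HeadIs_mem_P true) (comp_mem_FP tail_mem_FP (stepStr_mem_FP M hM)))))

/-- **Membership of a round word in the round condition.** [folklore] -/
theorem mem_roundT_iff (x Y J : List Bool) :
    boolPair (boolPair x Y) J ∈ roundT M ↔
      (J.length < (fstF Y).length → ∃ y, M.step x (ansTake Y J.length) = Sum.inl y) ∧
      (J.length = (fstF Y).length → M.step x (ansTake Y J.length) = Sum.inr true) := by
  have h1 := stepCode_mem_HeadIs_false_iff (M.step x (ansTake Y J.length))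
  have h2 := stepCode_output_true_iff (M.step x (ansTake Y J.length))
  change ((¬ boolPair (boolPair x Y) J ∈ SLt ∨ stepStr M (boolPair (boolPair x Y) J) ∈ HeadIs false) ∧
      ((boolPair (boolPair x Y) J ∈ SLt ∨ boolPair (boolPair x Y) J ∈ KLt) ∨
        (stepStr M (boolPair (boolPair x Y) J) ∈ HeadIs true ∧
          (stepStr M (boolPair (boolPair x Y) J)).tail ∈ HeadIs true))) ↔ _
  rw [stepStr_apply, mem_SLt_iff, mem_KLt_iff, h1, h2]
  constructor
  · rintro ⟨ha, hb⟩
    refine ⟨fun hlt => ha.resolve_left (fun h => h hlt), fun heq => ?_⟩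
    rcases hb with (h | h) | h
    · omega
    · omega
    · exact h
  · rintro ⟨ha, hb⟩
    refine ⟨?_, ?_⟩
    · by_cases hlt : J.length < (fstF Y).length
      · exact Or.inr (ha hlt)
      · exact Or.inl hlt
    · rcases Nat.lt_trichotomy J.length (fstF Y).length with h | h | h
      · exact Or.inl (Or.inl h)
      · exact Or.inr (hb h)
      · exact Or.inl (Or.inr h)

/-- **The replay language `R`**: every round `j < |w|` of `w = ⟨x, Y⟩` satisfies the round
condition. [folklore] -/
def replayR : Language Bool := {w | ∀ j < w.length, boolPair w (ones j) ∈ roundT M}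

/-- `replayR M ∈ P` for polynomial-time `M` (`Brick.ballLen_mem_P`). [cite: AroraBarakCC2009, §1.3 (bounded loops)] -/
theorem replayR_mem_P (hM : M.IsPolyTime encodingBoolBool) : replayR M ∈ Classes.P :=
  ballLen_mem_P (roundT_mem_P M hM)

/-- **The query/answer map `f`**: `⟨⟨x, Y⟩, J⟩ ↦ ⟨query of round |J|, a_{|J|}⟩` (the tail of the
replayed step code, the `|J|`-th guessed answer). [folklore] -/
noncomputable def qaFn : List Bool → List Bool :=
  pairFn (List.tail ∘ stepStr M) (elemFn ∘ fanoutFn sndF csbV)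

/-- `qaFn M ∈ FP` for polynomial-time `M`. [folklore] -/
theorem qaFn_mem_FP (hM : M.IsPolyTime encodingBoolBool) : qaFn M ∈ FP :=
  pairFn_mem_FP (comp_mem_FP tail_mem_FP (stepStr_mem_FP M hM))
    (comp_mem_FP elemFn_mem_FP (fanoutFn_mem_FP sndF_mem_FP csbV_mem_FP))

/-- Value of the query/answer map on a round word. [folklore] -/
theorem qaFn_apply (x Y J : List Bool) :
    qaFn M (boolPair (boolPair x Y) J) =
      boolPair (stepCode (M.step x (ansTake Y J.length))).tail (aOf Y J.length) := by
  simp [qaFn, stepStr_apply, elemFn_boolPair, aOf]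

end Languages

/-! ### Free-running transcripts: the answers -/

/-- The `i`-th answer of the free-running transcript is the oracle's answer to the query of round
`i`. [folklore] -/
theorem getElem_trans {β : Type} (M : OracleAlg β) (O : Oracle) (x : List Bool) {m i : ℕ} (hi : i < m)
    (h : i < (trans M O x m).length) : (trans M O x m)[i] = O (qryOf M x (trans M O x i)) := by
  have ht : (trans M O x m).take (i + 1) = trans M O x i ++ [O (qryOf M x (trans M O x i))] := by
    rw [trans_take M O x (by omega : i + 1 ≤ m), trans_succ]
  have hlen : (trans M O x i).length = i := length_trans M O x i
  have h2 : ((trans M O x m).take (i + 1))[i]'(by simp; omega) = (trans M O x m)[i] := List.getElem_take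
  rw [← h2, List.getElem_of_eq ht, List.getElem_append_right (by omega)]
  simp [hlen]

/-! ### The characterisation of `P^g` by the guarded ball -/

/-- **The witness polynomial**: `|Y| ≤ 2 q(n) + 2 + q(n) · (2 s(q(n)) + 2)` for the code `Y` of the
genuine transcript (at most `q(n)` answers, each of length `≤ s(q(n))`). [folklore] -/
noncomputable def qY (q s : Polynomial ℕ) : Polynomial ℕ :=
  Polynomial.C 2 * q + Polynomial.C 2 + q * (Polynomial.C 2 * s.comp q + Polynomial.C 2)

/-- **`P^g` is the guarded ball of the graph of `g`** along the replay language, the guard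
`|J| < k` and the query/answer map: for `L ∈ P^g` presented by `(M, q)` and `g` with answers of
length `≤ s` (`s` monotone through `Polynomial.eval`), `x ∈ L` iff some `Y` with `|Y| ≤ qY(|x|)` codes
an answer list whose replay consists of queries answered as the graph dictates and ends with the
output `1` — the certified answers are then the genuine ones, by induction on the rounds.
[cite: KabanetsImpagliazzo2003, Lemma 3 (p. 357)] -/
theorem mem_iff_mem_guardedBall {g : List Bool → ℕ} {s : Polynomial ℕ}
    (hs : ∀ u, (encodeNat (g u)).length ≤ s.eval u.length) {L : Language Bool} {M : OracleAlg Bool}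
    {q : Polynomial ℕ}
    (hq : ∀ x : List Bool, M.run (Oracle.ofFun g) (q.eval x.length) x = some (L.boolIndicator x) ∧
      ∀ y ∈ M.queries (Oracle.ofFun g) (q.eval x.length) x, y.length ≤ q.eval x.length)
    (x : List Bool) :
    x ∈ L ↔ x ∈ guardedBall (fnGraph g) (replayR M) SLt (qaFn M) (qY q s) := by
  classical
  set O := Oracle.ofFun g with hO
  constructor
  · -- the genuine transcript is a certified guess
    intro hx
    obtain ⟨hrun, hqry⟩ := hq x
    rw [(Set.mem_iff_boolIndicator (L : Set (List Bool)) x).1 hx] at hrun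
    obtain ⟨m, hm, hqs, hout⟩ := (run_eq_some_iff M O _ x true).1 hrun
    have hlen : (trans M O x m).length = m := length_trans M O x m
    -- the answers are short
    have hans : ∀ a ∈ trans M O x m, a.length ≤ s.eval (q.eval x.length) := by
      intro a ha
      obtain ⟨i, hi, rfl⟩ := List.getElem_of_mem ha
      have him : i < m := by rwa [hlen] at hi
      rw [getElem_trans M O x him]
      have hmem : qryOf M x (trans M O x i) ∈ M.queries O (q.eval x.length) x :=
        mem_queries_of_trans M O _ x i (by omega) fun i' hi' => hqs i' (by omega)
      have hql := hqry _ hmem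
      rw [hO, Oracle.ofFun_apply]
      exact (hs _).trans (TM2Iter.eval_mono s hql)
    refine ⟨boolPair (ones m) (body (trans M O x m)), ?_, ?_, ?_⟩
    · -- the length of the guess
      have hb := length_body_le hans
      rw [hlen] at hb
      simp only [length_boolPair, qY, eval_add, eval_mul, eval_C, eval_comp, ones, List.length_replicate]
      have h1 : m * (2 * s.eval (q.eval x.length) + 2) ≤ q.eval x.length * (2 * s.eval (q.eval x.length) + 2) :=
        Nat.mul_le_mul_right _ hm.le
      omega
    · -- the replay conditions
      intro j _
      rw [mem_roundT_iff]
      simp only [fstF_boolPair, ones, List.length_replicate]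
      refine ⟨fun hjm => ?_, fun hjm => ?_⟩
      · rw [show List.replicate m true = ones m from rfl, ansTake_code _ _ (by rw [hlen]; omega),
          trans_take M O x hjm.le]
        exact hqs j hjm
      · rw [show List.replicate m true = ones m from rfl, ansTake_code _ _ (by rw [hlen]; omega), hjm,
          List.take_of_length_le (by rw [hlen])]
        exact hout
    · -- the graph conditions
      intro j _ hjS
      rw [mem_SLt_iff, fstF_boolPair] at hjS
      simp only [ones, List.length_replicate] at hjS
      rw [qaFn_apply]
      simp only [ones, List.length_replicate]
      rw [show List.replicate m true = ones m from rfl, ansTake_code _ _ (by rw [hlen]; omega),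
        trans_take M O x hjS.le]
      obtain ⟨y, hy⟩ := hqs j hjS
      rw [hy, stepCode_inl, List.tail_cons, boolPair_mem_fnGraph_iff, aOf_code _ _ (by rw [hlen]; exact hjS),
        getElem_trans M O x hjS, qryOf_eq_of_step_eq hy]
  · -- a certified guess is the genuine transcript
    rintro ⟨Y, -, hR, hall⟩
    set k := (fstF Y).length with hk
    have hkw : k < (boolPair x Y).length := by
      have := length_fstF_sndF_le Y
      rw [length_boolPair]; omega
    have hround : ∀ j ≤ k, boolPair (boolPair x Y) (ones j) ∈ roundT M := fun j hj => hR j (by omega)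
    -- by induction, the guessed answers are the genuine ones
    have key : ∀ j ≤ k, ansTake Y j = trans M O x j := by
      intro j
      induction j with
      | zero => intro; rfl
      | succ j ih =>
        intro hj
        have hjk : j < k := hj
        have ih' := ih hjk.le
        have hT := (mem_roundT_iff M x Y (ones j)).1 (hround j hjk.le)
        simp only [ones, List.length_replicate] at hT
        obtain ⟨y, hy⟩ := hT.1 hjk
        have hG := hall j (by omega) (by rw [mem_SLt_iff]; simpa [ones] using hjk)
        rw [qaFn_apply] at hG
        simp only [ones, List.length_replicate] at hG
        rw [hy, stepCode_inl, List.tail_cons, boolPair_mem_fnGraph_iff] at hG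
        rw [ansTake_succ, ih', trans_succ, hG, ← ih', qryOf_eq_of_step_eq hy]
    -- hence the run outputs `1` at round `k`
    have hTk := (mem_roundT_iff M x Y (ones k)).1 (hround k le_rfl)
    simp only [ones, List.length_replicate] at hTk
    have hout : M.step x (trans M O x k) = Sum.inr true := by rw [← key k le_rfl]; exact hTk.2 rfl
    have hqs : ∀ i < k, ∃ y, M.step x (trans M O x i) = Sum.inl y := by
      intro i hi
      have hTi := (mem_roundT_iff M x Y (ones i)).1 (hround i hi.le)
      simp only [ones, List.length_replicate] at hTi
      rw [← key i hi.le]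
      exact hTi.1 hi
    have hrun : M.run O (k + 1) x = some true := (run_eq_some_iff M O _ x true).2 ⟨k, Nat.lt_succ_self k, hqs, hout⟩
    obtain ⟨hrunq, -⟩ := hq x
    refine (Set.mem_iff_boolIndicator (L : Set (List Bool)) x).2 ?_
    rcases le_or_gt (k + 1) (q.eval x.length) with hle | hgt
    · have := M.run_mono O x hle hrun
      rw [this] at hrunq
      exact (Option.some.inj hrunq).symm
    · have := M.run_mono O x hgt.le hrunq
      rw [this] at hrun
      exact Option.some.inj hrun

end FnGraph

/-! ### Kabanets–Impagliazzo, Lemma 3 for function oracles -/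

open FnGraph in
/-- **Kabanets–Impagliazzo 2003, Lemma 3 (function-oracle form, `NSUBEXP` instance).** If the graph
language `{⟨u, bin (g u)⟩}` of a function `g : {0,1}* → ℕ` with polynomially long values is in
`NSUBEXP`, then `P^g ⊆ NSUBEXP` (p. 357: "If `Perm ∈ NTIME(t)`, then
`P^{Perm} ⊆ NTIME(poly(n) t(poly(n)))`", with all `t = 2^{n^ε}` as on p. 359). Here `P^g` is the
tree's `PRel (Oracle.ofFun g)`. [cite: KabanetsImpagliazzo2003, Lemma 3 (p. 357) and proof of Thm. 18 (p. 359)] -/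
theorem PRel_ofFun_subset_NSUBEXP_of_fnGraph {g : List Bool → ℕ} {s : Polynomial ℕ}
    (hs : ∀ u, (encodeNat (g u)).length ≤ s.eval u.length) (hG : fnGraph g ∈ NSUBEXP) :
    PRel (Oracle.ofFun g) ⊆ NSUBEXP := by
  intro L hL
  obtain ⟨M, hM, q, hq⟩ := hL
  have heq : L = guardedBall (fnGraph g) (replayR M) SLt (qaFn M) (qY q s) :=
    Set.ext fun x => mem_iff_mem_guardedBall hs hq x
  rw [heq]
  exact mem_NSUBEXP_of_guardedBall _ hG (replayR_mem_P M hM) SLt_mem_P (qaFn_mem_FP M hM)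

end Literature.Computability.Complexity
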